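import Summits.AtomisticToContinuum.BoseEinsteinCondensation.Theorems.BECGroundStateSOSPeriodicIRBoundTwoSectorFloatingDefs
import Summits.AtomisticToContinuum.BoseEinsteinCondensation.Theorems.BECGroundStateSOSPeriodicIRBoundTwoSectorKato
import Summits.AtomisticToContinuum.BoseEinsteinCondensation.Theorems.BECGroundStateSOSPeriodicIRBoundTwoSectorKLST
import Summits.AtomisticToContinuum.BoseEinsteinCondensation.Theorems.BECGroundStateSOSPeriodicIRBoundTwoSectorWindowT
import Summits.AtomisticToContinuum.BoseEinsteinCondensation.Theorems.BECGroundStateSOSPeriodicIRBoundTwoSectorPooledToFloating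
import HarnessLib

/-!
# Route `BECGroundStateSOS`, crux `PeriodicIRBound` (stmt-AtomisticToContinuum-3972), line `two-sector-gd-transfer` v8 —
# standing reductions of the crux after the floating-threshold reshape (all own stubs discharged)

Supports (does not close) stmt-AtomisticToContinuum-3972. With the v7 stubs S4' (`stub_klsNearMinimiserT`, p152976), S5'
(`stub_windowAssemblyT`, p153397) and the bridge S8 (`stub_pooledToFloating`, p153818) landed, the skeleton
`Cruxes/PeriodicIRBound/Lines/two_sector_gd_transfer.lean` (v8-c22) has exactly two `sorry`s, S1' `FloatingTwoChannel` and S6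
`NonIntegrableHalf`. This module records the resulting sorry-free reductions BY NAME, per potential and globally:

* `irBoundFor_of_floatingFor` — for ONE integrable admissible `v`, the floating two-channel bound `FloatingFor v K ρ₀ C` ALONE
  gives the crux's infrared inequality `IRBoundFor v` (no Gaussian domination, no convexity, no further input);
* `floatingFor_of_gdFor_convexityFor` — for ONE integrable admissible `v`, `GDFor v K ρ₀ C ∧ ConvexityFor v ⇒ FloatingFor v K ρ₀' C`
  (Kato step p138476 + bridge p153818): the v6 inputs are a special case of the v7 input;
* `stub_integrableHalfOfFloatingAlone` — S1' ⇒ the integrable half of the crux;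
* `stub_periodicIRBoundOfFloating` — S1' ∧ S6 ⇒ `PeriodicIRBound` by name (the fourth standing reduction of the crux, next to
  `stub_periodicIRBoundOfPooled` p139109, `LinearPhFloorWagner.stub_reduction`, `FsumPhasePencil`'s);
* `stub_floatingOfPooled` — stmt-12620 ∧ stmt-9094 ⇒ S1' (so p139109 factors through S1').

Nothing is cited as a fact; every input is a landed theorem of the line.
-/

noncomputable section

open scoped BigOperators ENNReal
open Filter MeasureTheory

namespace Summit.AtomisticToContinuum.BoseEinsteinCondensation.Cruxes.PeriodicIRBound.TwoSectorGdTransfer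

open Literature.MathematicalPhysics.QuantumManyBody.BoseGas
open Summit.AtomisticToContinuum.BoseEinsteinCondensation.Theses.BECGroundStateSOS (PeriodicIRBound)
open Summit.AtomisticToContinuum.BoseEinsteinCondensation.Theses.BECTwoSectorGD (GaussianDomination)
open Summit.AtomisticToContinuum.BoseEinsteinCondensation.Theses.BECSectorPoincareTwoScale (EnergyConvexityWindow)
open Summit.AtomisticToContinuum.BoseEinsteinCondensation.Theorems.PeriodicIRBound.Negative
  (IRBoundFor periodicIRBound_iff_split)

/-! ### Per potential -/

/-- **The floating two-channel bound alone gives the crux for `v`**: for an integrable admissible `v` and data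
`K, ρ₀, C > 0`, `FloatingFor v K ρ₀ C → IRBoundFor v` (landed S4' and S5'). [folklore] -/
theorem irBoundFor_of_floatingFor {v : ℝ → ℝ≥0∞} (hv : IsRepulsiveFiniteRange v) (hint : (∫⁻ x : Space, v ‖x‖) ≠ ⊤)
    {K ρ₀ C : ℝ} (hK : 0 < K) (hρ₀ : 0 < ρ₀) (hC : 0 < C) (hF : FloatingFor v K ρ₀ C) : IRBoundFor v :=
  stub_windowAssemblyT v hv hint K ρ₀ C hK hρ₀ hC hF (stub_klsNearMinimiserT v hv hint)

/-- **The v6 inputs are a special case of the v7 input, per potential**: for an integrable admissible `v`, two-sector Gaussian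
domination with data `(K, ρ₀, C)` and midpoint near-convexity give the floating two-channel bound with the same `K, C` and some
`ρ₀' > 0` (landed Kato step + landed bridge S8). [folklore] -/
theorem floatingFor_of_gdFor_convexityFor {v : ℝ → ℝ≥0∞} (hv : IsRepulsiveFiniteRange v) (hint : (∫⁻ x : Space, v ‖x‖) ≠ ⊤)
    {K ρ₀ C : ℝ} (hK : 0 < K) (hρ₀ : 0 < ρ₀) (hC : 0 < C) (hGD : GDFor v K ρ₀ C) (hconv : ConvexityFor v) :
    ∃ ρ₀' : ℝ, 0 < ρ₀' ∧ FloatingFor v K ρ₀' C :=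
  stub_pooledToFloating v hv hint K ρ₀ C hK hρ₀ hC (stub_katoSusceptibility v hv hint K ρ₀ C hC hGD) hconv

/-! ### Global (registered by-products of the crux ledger) -/

/-- **Registered by-product `stub_integrableHalfOfFloatingAlone`**: S1' `FloatingTwoChannel` alone gives `IRBoundFor v` for
every INTEGRABLE admissible `v`. [folklore] -/
theorem stub_integrableHalfOfFloatingAlone :
    FloatingTwoChannel → ∀ v : ℝ → ℝ≥0∞, IsRepulsiveFiniteRange v → (∫⁻ x : Space, v ‖x‖) ≠ ⊤ → IRBoundFor v :=
  fun h1 => integrableHalf_of_floating h1 stub_klsNearMinimiserT stub_windowAssemblyT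

/-- **Registered by-product `stub_periodicIRBoundOfFloating`** — the fourth standing reduction of the crux: S1'
`FloatingTwoChannel` and the scope half S6 `NonIntegrableHalf` give `PeriodicIRBound` by name. [folklore] -/
theorem stub_periodicIRBoundOfFloating : FloatingTwoChannel → NonIntegrableHalf → PeriodicIRBound :=
  fun h1 h6 => periodicIRBound_iff_split.2 ⟨stub_integrableHalfOfFloatingAlone h1, h6⟩

/-- **Registered by-product `stub_floatingOfPooled`**: stmt-12620 `GaussianDomination` and stmt-9094 `EnergyConvexityWindow`
give S1' `FloatingTwoChannel` (Kato step p138476 and bridge p153818 discharged) — the v6 reduction p139109 factors through S1'.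
[folklore] -/
theorem stub_floatingOfPooled : GaussianDomination → EnergyConvexityWindow → FloatingTwoChannel :=
  fun hGD hC => floatingTwoChannel_of_pooled hGD hC stub_katoSusceptibility stub_pooledToFloating

end Summit.AtomisticToContinuum.BoseEinsteinCondensation.Cruxes.PeriodicIRBound.TwoSectorGdTransfer

end
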